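import Literature.Topology.FourManifolds.SlideFormulaLevel
import Literature.Topology.FourManifolds.SlideSeedExists
import Literature.Topology.FourManifolds.SlideBasisLoop
import Literature.Topology.FourManifolds.SlideLevelLoop
import HarnessLib

/-!
# The slides of a `1`-handle realise `x ↦ x · w` (or `x ↦ w · x`) for every `w` below the handle

Topic `Literature/Topology/FourManifolds` (fact seat
`provefact-Literature.Topology.FourManifolds.lauden-f709dd520c`, Laudenbach–Poénaru's Lemma 2: the
slide `H₃`, "`Φ₃(x₁) = x₁x₂`, `Φ₃(xᵢ) = xᵢ`", p. 339, "pushing one foot of the handle once around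
`x₂`", p. 340).  Everything here is **proved**; no named facts.

Let `C` be a slide context (`SlideContext.lean`) compatible with a left-sphere setting `L` of
the critical point `q` (`FeetOnLeftHandDisc.lean`), whose function has one critical point of
index `0`, below the seed level, and none of index `≥ 2`; let `C_q` be the arc of the handle,
`α₋`, `α₊` paths from a base point `x₀` (below `c - 3τ`) to its end points, inside
`{f ≤ c - 2τ}`, and `x = [α₋ · C_q · α₊⁻¹]`.  **For every loop `γ` at `x₀` inside
`{f ≤ c - 2τ}` there is a self-diffeomorphism `Ψ` of the manifold, the identity on
`{f ≤ c - 2τ}`, with `Ψ_# x = x · [γ]`** — or, depending on which foot of the handle the arc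
meets first, with `Ψ_# x = [γ] · x` for every such `γ` (`Compat.exists_slide_realise`;
concatenation read from left to right).

Mechanism (`exists_slide_realise_core`): write `x = [A₋ · K · A₊⁻¹]`
(`SlideBasisLoop.mk_arcLoop_eq`) with `A±` ending at the centres `v∓`, `v₊` of the flowed-down
feet discs in the seed level and `K` through the handle; conjugate `γ` to a loop of the seed
level at `v₊` (`SlideContext.exists_levelLoop`, `π₁(∂) → π₁` onto for the `1`-handlebody
`{f ≤ c}`); push `v₊` once around it by a seed diffeotopy fixing `v₋` throughout
(`SlideContext.exists_isSeed_homotopic`); extend to the slide diffeomorphism `Ψ`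
(`SlideContext.exists_diffeomorph`), which fixes `K` and `{f ≤ c - 2τ}` pointwise; the slide
formula (`mapOfEq_slide_arcLoop_level`) gives `Ψ_# x = x · [A₊ · λ₊ · A₊⁻¹]⁻¹ = x · [γ]⁻¹`.

## References

* F. Laudenbach, V. Poénaru, *A note on 4-dimensional handlebodies*, Bull. Soc. Math. France
  100 (1972) 337–344, §2, proof of Lemma 2 (pp. 339–340). [LaudenbachPoenaruBSMF1972]
* J. Milnor, *Lectures on the h-cobordism theorem* (1965), Thms. 3.13, 3.14.
  [MilnorHCobordism1965]
* A. Hatcher, *Algebraic Topology* (2002), Lemma 1.19, Prop. 1.26. [HatcherAT2002]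
-/

open scoped Manifold ContDiff Topology unitInterval
open Set Function Metric

noncomputable section

namespace Literature.Topology.FourManifolds

open Literature.AlgebraicTopology.FundamentalGroup

universe u

variable {n : ℕ} {M₀ N₀ : Type u} [TopologicalSpace M₀] [ChartedSpace (EuclideanSpace ℝ (Fin n)) M₀]
  [TopologicalSpace N₀] [ChartedSpace (EuclideanSpace ℝ (Fin n)) N₀]

namespace Cobordism.LeftSphereSetting.Compat

variable {c : Cobordism n M₀ N₀} {g : c.W → ℝ} {ξ : Π x : c.W, TangentSpace (𝓡∂ (n + 1)) x}
  {L : LeftSphereSetting c g ξ 0} {C : SlideContext n c.W}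

/-- **The slide realising `x ↦ x · [γ]⁻¹`** (core form: the loop is given as
`A₋ · K · A₊⁻¹` with `A₋` ending at the centre `v₋` of the `-` disc, `A₊` at the centre `v₊`
of the `+` disc of the seed level, and `K` running on the flow lines of the disc centres and on
the axis of the handle region). [cite: LaudenbachPoenaruBSMF1972, §2, proof of Lemma 2 (pp. 339–340)]
[cite: MilnorHCobordism1965, Thm. 3.13] [cite: HatcherAT2002, Lemma 1.19] -/
theorem exists_slide_realise_core (C : SlideContext n c.W)
    (h0 : (criticalSetOfIndex (𝓡∂ (n + 1)) C.S.f 0).ncard = 1)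
    (h2 : ∀ k, 2 ≤ k → (criticalSetOfIndex (𝓡∂ (n + 1)) C.S.f k).ncard = 0)
    (hmin : ∀ z ∈ criticalSetOfIndex (𝓡∂ (n + 1)) C.S.f 0, C.S.f z < C.c)
    {x₀ wm wp : c.W} (hx₀ : C.S.f x₀ ≤ C.c - 3 * C.τ)
    (ewm : wm = C.toCtx.Sl'.levelIncl (C.toCtx.disc' neg_one_sq 0))
    (ewp : wp = C.toCtx.Sl'.levelIncl (C.toCtx.disc' (one_pow 2) 0))
    (Am : Path x₀ wm) (Ap : Path x₀ wp)
    (hAm : ∀ s, C.S.f (Am s) ≤ C.c) (hAp : ∀ s, C.S.f (Ap s) ≤ C.c)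
    (K : Path wm wp)
    (hK : ∀ z ∈ range K, (z ∈ C.S.N ∧ C.S.a ≤ C.S.f z ∧ C.S.f z ≤ C.S.f C.S.p) ∨
      ∃ (s' : ℝ) (hs' : s' ^ 2 = 1) (t : ℝ), 0 ≤ t ∧ t ≤ C.S.a - C.c ∧
        z = C.S.θ (t, C.toCtx.Sl'.levelIncl (C.toCtx.disc' hs' 0)))
    (γ : Path x₀ x₀) (hγ : ∀ s, C.S.f (γ s) ≤ C.c - 2 * C.τ) :
    ∃ (Ψ : c.W ≃ₘ⟮𝓡∂ (n + 1), 𝓡∂ (n + 1)⟯ c.W) (hΨ : Ψ x₀ = x₀),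
      (∀ x, C.S.f x ≤ C.c - 2 * C.τ → Ψ x = x) ∧
      FundamentalGroup.mapOfEq (SlideContext.slideMap Ψ) hΨ
          (FundamentalGroup.fromPath (Path.Homotopic.Quotient.mk ((Am.trans K).trans Ap.symm))) =
        FundamentalGroup.fromPath
          ((Path.Homotopic.Quotient.mk ((Am.trans K).trans Ap.symm)).trans (Path.Homotopic.Quotient.mk γ).symm) := by
  subst ewm ewp
  have hτ := C.τ_pos; have hη := C.S.η_pos; have hε := C.S.ε_pos; have hδ := C.S.δ_pos
  have hc_le : C.c + 8 * C.τ ≤ C.S.a - 24 * C.S.ε ^ 2 := by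
    have := C.toCtx.c_le; simpa only [SlideContext.toCtx_c, SlideContext.toCtx_τ, SlideContext.toCtx_S] using this
  obtain ⟨hcut1, hcut2, hcut3, hcut4⟩ := C.cut_lt
  -- the level loop `β` with `[A₊ · β · A₊⁻¹] = [γ]`
  obtain ⟨β, hβ⟩ := C.exists_levelLoop h0 h2 hmin (C.toCtx.disc' (one_pow 2) 0) Ap hAp γ (fun s => (hγ s).trans (by linarith))
  -- the seed diffeotopy pushing `v₊` around `β`, fixing `v₋`
  obtain ⟨ψ, hψ, hfixm, -, hfixp, β', hβ', hββ'⟩ := C.exists_isSeed_homotopic (C.toCtx.disc' (one_pow 2) 0) β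
  -- the slide diffeomorphism
  obtain ⟨g₁, g₁', η₀, N, hη₀, hη₀', hA, hP, hfeet, Ψ, hbelow, hconj, hΨ⟩ := C.exists_diffeomorph hψ
  have hid : ∀ x, C.S.f x ≤ C.c - 2 * C.τ → Ψ x = x := fun x hx => by
    rw [SlideContext.slide_apply_of_lt hη₀ hη₀' hA hP hfeet hbelow hΨ (by linarith)]
    exact C.susp_eq_self ψ (Or.inl hx)
  have hΨx₀ : Ψ x₀ = x₀ := hid x₀ (by linarith)
  -- `Ψ` fixes `K` pointwise
  have hfix1 : ∀ {s' : ℝ} (hs' : s' ^ 2 = 1), ψ.toFun 1 (C.toCtx.disc' hs' 0) = C.toCtx.disc' hs' 0 := by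
    intro s' hs'
    rcases sq_eq_one_iff.mp hs' with rfl | rfl
    · exact hfixp
    · exact hfixm 1
  have hΨK : ∀ s, Ψ (K s) = K s := by
    intro s
    rcases hK (K s) (mem_range_self s) with ⟨hN, -, hle⟩ | ⟨s', hs', t, ht0, ht1, hz⟩
    · refine SlideContext.slide_eq_self_of_mem_N hη₀ hη₀' hA hP hfeet hΨ hN (hle.trans ?_)
      rw [C.hℓu_eq, C.hδ_eq]; nlinarith
    · rw [hz]
      exact SlideContext.slide_flow_levelIncl hη₀ hη₀' hA hP hfeet hconj hΨ (hfix1 hs') ht0 (by linarith)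
  -- the data in `X = {f ≤ a - η}`
  have hx₀c : C.S.f x₀ ≤ C.cut := by linarith
  set x₀' : ↥(C.S.f ⁻¹' Iic C.cut) := ⟨x₀, hx₀c⟩ with hx₀'
  set αm := VanKampen.liftPath (C.S.f ⁻¹' Iic C.cut) Am (fun s => show C.S.f (Am s) ≤ C.cut from (hAm s).trans (by linarith)) with hαm
  set αp := VanKampen.liftPath (C.S.f ⁻¹' Iic C.cut) Ap (fun s => show C.S.f (Ap s) ≤ C.cut from (hAp s).trans (by linarith)) with hαp
  have hΨx₀' : SlideContext.slideMap Ψ (C.inclCut x₀') = C.inclCut x₀' := hΨx₀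
  have key := SlideContext.mapOfEq_slide_arcLoop_level hη₀ hη₀' hA hP hfeet hbelow hconj hΨ (x₀ := x₀') hx₀ hΨx₀'
    (vm := C.toCtx.disc' neg_one_sq 0) (vp := C.toCtx.disc' (one_pow 2) 0) hfixm hfixp αm αp K hΨK
  -- the same identity, read on the paths of `M` (the lifted paths map back to `A∓` definitionally)
  have key' : FundamentalGroup.mapOfEq (SlideContext.slideMap Ψ) hΨx₀
      (FundamentalGroup.fromPath (Path.Homotopic.Quotient.mk ((Am.trans K).trans Ap.symm))) =
      FundamentalGroup.fromPath ((Path.Homotopic.Quotient.mk ((Am.trans K).trans Ap.symm)).trans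
        (Path.Homotopic.Quotient.mk ((Ap.trans (C.levelTrack ψ hfixp)).trans Ap.symm)).symm) := by
    exact key
  -- the track of `v₊` is `β'`, homotopic to `β`
  have etrack : C.levelTrack ψ hfixp = β'.map ((continuous_subtype_val.comp continuous_subtype_val) :
      Continuous (C.toCtx.Sl'.levelIncl : C.toCtx.Sl'.Level (C.toCtx.c + C.toCtx.σ) → c.W)) := by
    ext s
    show ((C.toCtx.Sl'.levelIncl (ψ.toFun s (C.toCtx.disc' (one_pow 2) 0))) : c.W) = C.toCtx.Sl'.levelIncl (β' s)
    rw [hβ' s]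
  have htrack : Path.Homotopic.Quotient.mk (C.levelTrack ψ hfixp) =
      Path.Homotopic.Quotient.mk (β.map ((continuous_subtype_val.comp continuous_subtype_val) :
        Continuous (C.toCtx.Sl'.levelIncl : C.toCtx.Sl'.Level (C.toCtx.c + C.toCtx.σ) → c.W))) := by
    rw [etrack]
    exact Quotient.sound (hββ'.map ⟨_, continuous_subtype_val.comp continuous_subtype_val⟩)
  have hconjγ : Path.Homotopic.Quotient.mk ((Ap.trans (C.levelTrack ψ hfixp)).trans Ap.symm) = Path.Homotopic.Quotient.mk γ := by
    rw [Path.Homotopic.Quotient.mk_trans, Path.Homotopic.Quotient.mk_trans, htrack]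
    rw [Path.Homotopic.Quotient.mk_trans, Path.Homotopic.Quotient.mk_trans] at hβ
    exact hβ
  refine ⟨Ψ, hΨx₀, hid, ?_⟩
  rw [hconjγ] at key'
  exact key'

/-! ### The slides of the handle, for the basis loop -/

variable (h : Compat L C)
  {e₀ e₁ : c.W} (Cq : Path e₀ e₁) (hinj : Injective Cq) (hrange : range Cq = leftHandDisc (𝓡∂ (n + 1)) g ξ L.q L.b)
  (hnn : ∀ z, 0 ≤ mlineDeriv (𝓡∂ (n + 1)) C.S.f z (ξ z))
  (hpos : ∀ z, ¬ IsMCriticalPt (𝓡∂ (n + 1)) g z → 0 < mlineDeriv (𝓡∂ (n + 1)) C.S.f z (ξ z))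

/-- Group bookkeeping: from `Ψ_# (x⁻¹) = x⁻¹ · [γ]⁻¹` deduce `Ψ_# x = [γ] · x`. [folklore] -/
theorem mapOfEq_eq_of_symm {X : Type*} [TopologicalSpace X] {F : C(X, X)} {x₀ : X} (hF : F x₀ = x₀)
    {L L' : Path x₀ x₀} (γ : Path x₀ x₀)
    (hL' : Path.Homotopic.Quotient.mk L' = (Path.Homotopic.Quotient.mk L).symm)
    (hcore : FundamentalGroup.mapOfEq F hF (FundamentalGroup.fromPath (Path.Homotopic.Quotient.mk L')) =
      FundamentalGroup.fromPath ((Path.Homotopic.Quotient.mk L').trans (Path.Homotopic.Quotient.mk γ).symm)) :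
    FundamentalGroup.mapOfEq F hF (FundamentalGroup.fromPath (Path.Homotopic.Quotient.mk L)) =
      FundamentalGroup.fromPath ((Path.Homotopic.Quotient.mk γ).trans (Path.Homotopic.Quotient.mk L)) := by
  have e1 : FundamentalGroup.fromPath (Path.Homotopic.Quotient.mk L') =
      (FundamentalGroup.fromPath (Path.Homotopic.Quotient.mk L))⁻¹ := by
    rw [FundamentalGroup.inv_def]; exact hL'
  have e2 : FundamentalGroup.fromPath ((Path.Homotopic.Quotient.mk L').trans (Path.Homotopic.Quotient.mk γ).symm) =
      (FundamentalGroup.fromPath ((Path.Homotopic.Quotient.mk γ).trans (Path.Homotopic.Quotient.mk L)))⁻¹ := by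
    rw [FundamentalGroup.inv_def, hL']
    exact (IsotopyTrack.quotient_symm_trans _ _).symm
  rw [e1, map_inv, e2] at hcore
  exact inv_injective hcore

include h hinj hrange hnn hpos in
/-- **The slides of a `1`-handle realise `x ↦ x · [γ]` — or `x ↦ [γ] · x` — for every loop `γ`
below the seed collar** (see the module docstring; which of the two depends only on the handle
and the arc, not on `γ`). [cite: LaudenbachPoenaruBSMF1972, §2, proof of Lemma 2 (pp. 339–340)]
[cite: MilnorHCobordism1965, Thm. 3.13] [cite: HatcherAT2002, Lemma 1.19] -/
theorem exists_slide_realise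
    (h0 : (criticalSetOfIndex (𝓡∂ (n + 1)) C.S.f 0).ncard = 1)
    (h2 : ∀ k, 2 ≤ k → (criticalSetOfIndex (𝓡∂ (n + 1)) C.S.f k).ncard = 0)
    (hmin : ∀ z ∈ criticalSetOfIndex (𝓡∂ (n + 1)) C.S.f 0, C.S.f z < C.c)
    {x₀ : c.W} (hx₀ : C.S.f x₀ ≤ C.c - 3 * C.τ) (αm : Path x₀ e₀) (αp : Path x₀ e₁)
    (hαm : ∀ s, C.S.f (αm s) ≤ C.c - 2 * C.τ) (hαp : ∀ s, C.S.f (αp s) ≤ C.c - 2 * C.τ) :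
    (∀ γ : Path x₀ x₀, (∀ s, C.S.f (γ s) ≤ C.c - 2 * C.τ) →
      ∃ (Ψ : c.W ≃ₘ⟮𝓡∂ (n + 1), 𝓡∂ (n + 1)⟯ c.W) (hΨ : Ψ x₀ = x₀),
        (∀ x, C.S.f x ≤ C.c - 2 * C.τ → Ψ x = x) ∧
        FundamentalGroup.mapOfEq (SlideContext.slideMap Ψ) hΨ
            (FundamentalGroup.fromPath (Path.Homotopic.Quotient.mk ((αm.trans Cq).trans αp.symm))) =
          FundamentalGroup.fromPath
            ((Path.Homotopic.Quotient.mk ((αm.trans Cq).trans αp.symm)).trans (Path.Homotopic.Quotient.mk γ))) ∨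
    (∀ γ : Path x₀ x₀, (∀ s, C.S.f (γ s) ≤ C.c - 2 * C.τ) →
      ∃ (Ψ : c.W ≃ₘ⟮𝓡∂ (n + 1), 𝓡∂ (n + 1)⟯ c.W) (hΨ : Ψ x₀ = x₀),
        (∀ x, C.S.f x ≤ C.c - 2 * C.τ → Ψ x = x) ∧
        FundamentalGroup.mapOfEq (SlideContext.slideMap Ψ) hΨ
            (FundamentalGroup.fromPath (Path.Homotopic.Quotient.mk ((αm.trans Cq).trans αp.symm))) =
          FundamentalGroup.fromPath
            ((Path.Homotopic.Quotient.mk γ).trans (Path.Homotopic.Quotient.mk ((αm.trans Cq).trans αp.symm)))) := by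
  have hτ := C.τ_pos
  have he₀ : C.S.f e₀ ≤ C.c := by have := hαm 1; rw [αm.target] at this; linarith
  have he₁ : C.S.f e₁ ≤ C.c := by have := hαp 1; rw [αp.target] at this; linarith
  obtain ⟨sg, D₁, D₃, O₁, P₂, O₃, hsg1, hD₁, hD₃, hO₁, hO₃, hP₂N, -, hloop⟩ :=
    h.mk_arcLoop_eq Cq hinj hrange hnn hpos he₀ he₁ αm αp
  have hwm : C.toCtx.Sl'.levelIncl (C.toCtx.disc' neg_one_sq 0) = C.S.θ (-(C.S.a - C.c), C.S.D.foot (-1) C.toCtx.m C.toCtx.ρ 0) :=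
    (theta_neg_foot C neg_one_sq).symm
  have hwp : C.toCtx.Sl'.levelIncl (C.toCtx.disc' (one_pow 2) 0) = C.S.θ (-(C.S.a - C.c), C.S.D.foot 1 C.toCtx.m C.toCtx.ρ 0) :=
    (theta_neg_foot C (one_pow 2)).symm
  have hAmle : ∀ s, C.S.f ((αm.trans D₁.symm) s) ≤ C.c := fun s => by
    rw [Path.trans_apply]; split_ifs
    · exact (hαm _).trans (by linarith)
    · exact hD₁ _
  have hAple : ∀ s, C.S.f ((αp.trans D₃.symm) s) ≤ C.c := fun s => by
    rw [Path.trans_apply]; split_ifs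
    · exact (hαp _).trans (by linarith)
    · exact hD₃ _
  rcases hsg1 with rfl | rfl
  · -- the arc meets the `+` foot first: realise `x ↦ [γ] · x` through the reversed loop
    right
    intro γ hγ
    have hKpts : ∀ z ∈ range ((O₁.symm.trans P₂).trans O₃).symm, (z ∈ C.S.N ∧ C.S.a ≤ C.S.f z ∧ C.S.f z ≤ C.S.f C.S.p) ∨
        ∃ (s' : ℝ) (hs' : s' ^ 2 = 1) (t : ℝ), 0 ≤ t ∧ t ≤ C.S.a - C.c ∧
          z = C.S.θ (t, C.toCtx.Sl'.levelIncl (C.toCtx.disc' hs' 0)) := by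
      intro z hz
      rw [Path.symm_range, Path.trans_range, Path.trans_range, Path.symm_range] at hz
      rcases hz with (⟨s, rfl⟩ | ⟨s, rfl⟩) | ⟨s, rfl⟩
      · obtain ⟨t, ht0, ht1, hts⟩ := hO₁ s
        exact Or.inr ⟨1, one_pow 2, t, ht0, ht1, by rw [hts, ← hwp]⟩
      · exact Or.inl (hP₂N s)
      · obtain ⟨t, ht0, ht1, hts⟩ := hO₃ s
        exact Or.inr ⟨-1, neg_one_sq, t, ht0, ht1, by rw [hts, ← hwm]⟩
    obtain ⟨Ψ, hΨ, hid, hcore⟩ := exists_slide_realise_core C h0 h2 hmin hx₀ hwm.symm hwp.symm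
      (αp.trans D₃.symm) (αm.trans D₁.symm) (fun s => hAple s) (fun s => hAmle s) ((O₁.symm.trans P₂).trans O₃).symm hKpts γ hγ
    refine ⟨Ψ, hΨ, hid, mapOfEq_eq_of_symm hΨ γ ?_ hcore⟩
    rw [hloop]
    simp only [Path.Homotopic.Quotient.mk_trans, Path.Homotopic.Quotient.mk_symm,
      IsotopyTrack.quotient_symm_trans, IsotopyTrack.quotient_symm_symm, Path.Homotopic.Quotient.trans_assoc]
  · -- the arc meets the `-` foot first: realise `x ↦ x · [γ]`
    left
    intro γ hγ
    have eplus : C.S.θ (-(C.S.a - C.c), C.S.D.foot (-(-1)) C.toCtx.m C.toCtx.ρ 0) =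
        C.S.θ (-(C.S.a - C.c), C.S.D.foot 1 C.toCtx.m C.toCtx.ρ 0) := by rw [neg_neg]
    have hKpts : ∀ z ∈ range ((O₁.symm.trans P₂).trans O₃), (z ∈ C.S.N ∧ C.S.a ≤ C.S.f z ∧ C.S.f z ≤ C.S.f C.S.p) ∨
        ∃ (s' : ℝ) (hs' : s' ^ 2 = 1) (t : ℝ), 0 ≤ t ∧ t ≤ C.S.a - C.c ∧
          z = C.S.θ (t, C.toCtx.Sl'.levelIncl (C.toCtx.disc' hs' 0)) := by
      intro z hz
      rw [Path.trans_range, Path.trans_range, Path.symm_range] at hz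
      rcases hz with (⟨s, rfl⟩ | ⟨s, rfl⟩) | ⟨s, rfl⟩
      · obtain ⟨t, ht0, ht1, hts⟩ := hO₁ s
        exact Or.inr ⟨-1, neg_one_sq, t, ht0, ht1, by rw [hts, ← hwm]⟩
      · exact Or.inl (hP₂N s)
      · obtain ⟨t, ht0, ht1, hts⟩ := hO₃ s
        exact Or.inr ⟨1, one_pow 2, t, ht0, ht1, by rw [hts, eplus, ← hwp]⟩
    obtain ⟨Ψ, hΨ, hid, hcore⟩ := exists_slide_realise_core C h0 h2 hmin hx₀ hwm.symm (eplus.trans hwp.symm)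
      (αm.trans D₁.symm) (αp.trans D₃.symm) (fun s => hAmle s) (fun s => hAple s) ((O₁.symm.trans P₂).trans O₃) hKpts
      γ.symm (fun s => hγ _)
    refine ⟨Ψ, hΨ, hid, ?_⟩
    rw [← hloop, Path.Homotopic.Quotient.mk_symm, IsotopyTrack.quotient_symm_symm] at hcore
    exact hcore

end Cobordism.LeftSphereSetting.Compat

end Literature.Topology.FourManifolds
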